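import Literature.MathematicalPhysics.QuantumFieldTheory.Balaban1983to89.B9Eq381KnitCubeBoxKernelY
import Literature.MathematicalPhysics.QuantumFieldTheory.Balaban1983to89.B9Cor35GDirAtKnitCubeLetters

/-!
# `Balaban1983to89.B9Cor35GDirKnitAvgPieceMajorant` — T. Bałaban, *Propagators for lattice gauge theories in a background field*, Commun. Math. Phys. **99** (1985)
# 389–434 [Balaban1985BackgroundPropagators] (3.80)–(3.83) pp. 406–407, (3.26) p. 395, p. 409 l. 1–5: ★★★ **[B9] (3.83) FOR THE KNIT PAIR OF THE CUBE SEQUENCE IN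
# [4]'s BLOCK-MAJORANT CURRENCY** — the averaging piece `Q*_□(1)a_□Q_□(1) − Q*_□(Ṽ)a_□Q_□(Ṽ)` of the (3.84) remainder at the letter of record `(QknitCubeY, QsknitCubeY)`,
# realified (`avgPieceCKnit`), HAS THE `P₂`-SHAPED MAJORANT `κ₂·α₁·((Lⁿη)²)⁻¹·e^{−δd}` over the cube sequence's blocks: the `hAv` input of dag-n06-c's
# ✓`B9Cor35GDirAtCubeLetters.h385_dirB_of_pieces` ∕ `cor35_GDir_of_pieces` at the Dirichlet bond letter (C) — piece (t57), seat dag-n06-j g40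

statement-level skeleton of published theorems with citation tags; proofs where landed; nothing here is a claim about the Yang–Mills mass gap

THE PRINT.  p. 407 (3.83): *«The operator P₂(A) is a sum of three terms obtained by the expansion of averaging operators. It is a semi-local operator … It satisfies
the bound |(P₂(A)A′)(b)| ≦ O(1)α₁(Lʲη)⁻²|A′|, b ∈ B_j(Λ_j), (3.83) with the norm |A′| restricted to the blocks defined above … Using the bounds (3.73), (3.77), (3.83)
and assuming that Theorem 3.3 holds for G(U), we get |(V(A)G(U)J)(b)| ≦ O(1)α₁e^{−(1/2)δ₀d(y,y′)}|J| … (3.85)»*; p. 406 (3.80)–(3.81) (`Q_j(U′U) = Q_j(U) + F_{2,j}(A)`,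
`|F_{2,j}(A)A′| ≦ O(1)α₁Q″_j|A′|`, the same for `Q*_j`); (3.82) p. 407 (the three averaging terms); (3.26) p. 395 (`Q*aQ` in `Δ_a`); (3.37) p. 396 (`|A| < α₁(Lʲη)⁻¹` on
`Ω_j`); p. 409 l. 1–5 (the operators of `{Ω_n(□)}`); Cor. 3.5 p. 407 («for U = 1 these theorems were proved in [4]»).  [4] = [Balaban1984PropagatorsII] (2.16) p. 225,
(2.20) p. 226, (2.51) p. 232; [5] = [Balaban1985Averaging] Proposition 7 p. 43, (141) p. 39.

WHY THIS FILE (cell `pub-ymgap`, node N06; HOME `T57-ROADMAP-g39.md`; dag-n06-d g35: «(t57) is n06-j's»).  dag-n06-c's FILE 4 takes the averaging word `AV` of the (C)-letter's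
split (`dirB_split_CK`, ✓`B9Cor35GDirAtKnitCubeLetters`) with a (3.83)-shaped majorant `hAv : AV ≺ κ₂·α₁·(len)⁻²·e^{−δd}` over `toB6 (geoCK i □) Rr H`, `blkBK i □`.  At r05's
STRAIGHT pair this is ✓`B9Cor35GCubeAvgPiece.hasMajorant_avgPieceK`; THIS FILE is its KNIT twin, assembled from: the rows of `Q_□(Ṽ) − Q_□(1)` = ✓`B9Eq380KnitRowVariationY.
norm_QknitCubeY_mulY_sub_apply_le` (g39) AT THE BASE `U := 1` (`reg335P_one`, gauge group `U(N)`), the flat faces `Q_□(1) = (qKc)♯`, `Q*_□(1) = (qsKc)♯`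
(✓`B9Eq3115KnitCubeLetterY`), the adjoint's columns and the box kernel's support geometry ∕ column mass (✓`B9Eq381KnitCubeBoxKernelY`, part 1), r05's weights and windows
(`wCubeBond_le`, `cf_div_pow_sq`, `sum_qKc_col_le_plateau`), through dag-n06-c's reading-to-majorant lemma `B9SectBGpReadingsY.hasMajorant_conj_of_liftY_bound`.

WHAT IS PROVED (sorry-free; one `def` with body — the real constant `kappaAvKnit`; theorems).
* §1 `kappaAvKnit d ℓ N b₁ ϱ′ α₁ δ = 4(d+1)·(9∕(2ϱ′))·b₁·L^{d+1}·(N⁴ + 1 + 2(d+1)N⁴·(9∕(2ϱ′))α₁)·e^{δ(2ℓ+6)}`, `kappaAvKnit_nonneg`, `wCubeBond_le_window`.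
* §2 (`𝔸 = M_N(ℂ)`, base `U = 1`, perturbation `Ṽ = e^{iηa}·1` with print's (3.37) smallness `Lʲη‖a‖ ≤ α₁` on the end blocks of every index bond of `{Ω_n(□)}`, the x-free
  numerics of the g39 engine): ★ `norm_QknitCubeY_fluct_sub_one_apply_le` (the F₂ row kernel `(9∕(2ϱ′))α₁·boxKP`), ★★★ `norm_avgPieceKnit_liftY_apply_le` — (3.83) AS A BLOCK BOUND ON
  PRODUCT INPUTS `g ⊗ E` (supported in the cube block `y′`, `|g| ≤ B`, `‖E‖ ≤ 1`): `‖((Q*_□(Ṽ)a_□Q_□(Ṽ) − Q*_□(1)a_□Q_□(1))(g ⊗ E))(b)‖ ≤ κ·α₁·((Lⁿη)²)⁻¹·e^{−δd(y(b),y′)}·B`,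
  `n` the level of the cube block of `b` (three terms of (3.82): `F₂*·aQ(1)`, `Q*(1)·aF₂`, `F₂*·aF₂`; the double support's locality `e^{δ(2ℓ+6)}e^{−δd} ≥ 1`).
* §3 ★★★ `hasMajorant_avgPieceCKnit` — **THE `hAv` BINDER OF dag-n06-c's `h385_dirB_of_pieces` AT THE KNIT PAIR, VERBATIM SHAPE**: for any `Ṽ` with `Ṽ_μ(x) = fluct η a μ x`
  (hypothesis `hV`; r05's `locCfgY`-type pins plug by their `_apply` lemma), `avgPieceCKnit b i □ Ṽ ≺ ((M₂Σ‖b_j‖)·κ)·α₁·(len²)⁻¹·e^{−δd}` over `toB6 (geoCK i □) Rr H` with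
  `blkBK i □`, every `δ ≥ 0`; ★★ `hasMajorant_avgPieceCKnit_of_cplx337` — the same with the end-block law discharged from r06's nested class (3.37) (`Cplx337 … (levV1 i) α₁ a`,
  `α₁ ↦ L·α₁`, ✓`endBlock_small_of_cplx337_cube`).
HONEST SCOPE.  Finite lattice algebra over landed letters; every analytic input is dag-n06-l's ∕ this lineage's (3.80)–(3.81) engine ([5] Prop. 7) and r05's flat bookkeeping,
USED BY NAME.  DISPLAYED: the x-free numerics of the engine (`α₀′, ϱ′, ϱ`, thresholds), `0 < α₀` with `K_pl(Mα₀)L⁴ < α₀′` (the (3.35) class at `U = 1` is free: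
`reg335P_one`), the weight band `0 < b₀ ≤ b₁`, the basis constant `M₂`, the smallness `Lʲη‖a‖ ≤ α₁` on end blocks (or the class (3.37)), `3α₁ ≤ ϱ′`.  Print's `O(1)α₁(Lʲη)⁻²` is
`κ·α₁·((Lⁿη)²)⁻¹` with `κ` explicit (depending on `d, L, N, b₁, ϱ′, δ` and affinely on `α₁`); the factor `N⁴` is the crude entry bookkeeping of the trace-pairing adjoint.  The
Laplacian and projection pieces of `h385`, the `U = 1` rows `hG hDG`, and the assembly are NOT here (dag-n06-c's road (B5)).  COUNT-NEUTRAL (`--supports stmt-QuantumFields-27364`);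
N06 NOT discharged; K1⁹ NOT closed; nothing continuum ∕ ℝ⁴ ∕ OS ∕ mass gap ∕ Clay — the Yang–Mills mass gap is NOT proved here.  NEW file; nothing landed is modified.  No `sorry`,
no `axiom`, no `instance`, no `notation`.  Net new unproved facts: 0.  Seat `pub-ymgap-dag-n06-j` (g40), 2026-08-31.
RELATED, NOT DUPLICATED (searched 2026-08-31: `rg 'kappaAvKnit|hasMajorant_avgPieceCKnit|norm_avgPieceKnit|QknitCubeY_fluct_sub_one'` over `Literature ∕ Summits` = ∅): r05
`B9Cor35GCubeAvgPiece` (the straight pair; its §3–§4 are the model, its §2 lemmas USED BY NAME), dag-n06-l `B9SectBQVarLawsOfKernelY` (the MEMBER pair's K2-G packaging in the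
`geo9K` currency — a different block map and carrier).
-/

noncomputable section

namespace Literature.MathematicalPhysics.QuantumFieldTheory.Balaban1983to89.B9Cor35GDirKnitAvgPieceMajorant

open scoped BigOperators
open B7Prop2Explicit (C0 c2' unitaryUnits unitaryUnits_le_U1)
open B7Prop3Flat (c3)
open B7Prop5CplxLevels (epsCplx tauCplx)
open B5Eq118OneStroke (iterBlockOf)
open B6GlobalChartV1 (PV)
open B6GlobalChartV1L0 (blkV1)
open B6KLevelCensusIndexV1 (KIdx kGeo)
open B6Cover236MultiLevelBlocks (cubes)
open B6RandomWalk (HasMajorant hasMajorant_mono)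
open B9Thm34Ext (toB6)
open B9CubeLettersOpsL0 (cubeFamY)
open B9CubeLettersBondOpsL0 (IBondCubeY BlkCubeY qKc qsKc aCubeY)
open B9CubeBondWeights (wCubeBond wCubeBond_pos)
open B9CubeGeometryInputs (geoCK)
open B9Cor35GCubeInputsAtOne (blkBK)
open B9Eq383CubeLetters (apply_sub_apply_eq_three_terms sum_qKc_eq_one norm_aCubeY_apply qKc_nonneg)
open B9Cor35GCubeAvgPiece (wCubeBond_le cf_div_pow_sq sum_qKc_col_le_plateau)
open B9CubeBondRowAgreementNearH (ends_of_qKc_ne_zero)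
open B9Eq3115KnitCubeLetterY (QknitCubeY QsknitCubeY QknitCubeY_one_liftMatY)
open B9Eq380KnitRowVariationY (boxKP boxKP_nonneg norm_QknitCubeY_mulY_sub_apply_le endBlock_small_of_cplx337_cube)
open B9Eq381KnitCubeBoxKernelY (sum_boxKP_le ends_of_boxKP_ne_zero lvl_window_of_ends dist_blkV1_le_of_ends_ends sum_boxKP_col_le_plateau norm_liftMatY_apply_le
  norm_QsknitCubeY_one_apply_le norm_QsknitCubeY_sub_one_apply_le_of_rowKernel)
open B9C2FormBoxRegimeY (Kpl)
open B9BackgroundsKLevelV1P (bg9KP reg335P_one)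
open B9BackgroundsKLevelV1 (levV1 shiftsV1)
open B9Eq335RegularityClasses (Cplx337)
open B9Eq39Adjoint (fluct)
open B9SectBGpReadingsY (hasMajorant_conj_of_liftY_bound)
open B9Cor35GDirAtKnitCubeLetters (avgPieceCKnit avgPieceCQK)
open B9Eq352DivFormLetters (conj)
open Node00

variable {d ℓ : ℕ} {hd : 1 ≤ d + 1} {hL : Odd (ℓ + 1) ∧ 1 < ℓ + 1} {b₀ b₁ : ℝ}

/-! ## §1 The constant of the knit averaging piece and the weights against the level window -/

section Constants

/-- **THE CONSTANT OF THE KNIT AVERAGING PIECE**: `κ = 4(d+1)·(9∕(2ϱ′))·b₁·L^{d+1}·(N⁴ + 1 + 2(d+1)N⁴·(9∕(2ϱ′))α₁)·e^{δ(2ℓ+6)}` — print's `O(1)` of (3.83) at the knit pair with every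
factor explicit: `(9∕(2ϱ′))α₁` is the F₂ row mass of [5] Prop. 7 per unit box mass, `4(d+1)` ∕ `2(d+1)` the box kernel's column ∕ row masses, `N⁴` the entry bookkeeping of the
trace-pairing adjoint, `b₁L^{d+1}` the weight band against the two contributing plateaus, `e^{δ(2ℓ+6)}` the price of the exponential form over the semi-local support.
[cite: Balaban1985BackgroundPropagators, (3.83) p.407 («O(1)α₁(Lʲη)⁻²»), (3.81) p.406] -/
def kappaAvKnit (d ℓ N : ℕ) (b₁ ϱ' α₁ δ : ℝ) : ℝ :=
  4 * ((d : ℝ) + 1) * (9 / (2 * ϱ')) * b₁ * (((ℓ + 1 : ℕ) : ℝ) ^ (d + 1)) *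
    ((N : ℝ) ^ 4 + 1 + 2 * ((d : ℝ) + 1) * (N : ℝ) ^ 4 * (9 / (2 * ϱ') * α₁)) * Real.exp (δ * (2 * (ℓ : ℝ) + 6))

/-- `κ ≥ 0` for `b₁, α₁ ≥ 0`, `ϱ′ > 0`. [cite: Balaban1985BackgroundPropagators, (3.83) p.407, bookkeeping] -/
theorem kappaAvKnit_nonneg {N : ℕ} {b₁' ϱ' α₁ δ : ℝ} (hb : 0 ≤ b₁') (hϱ' : 0 < ϱ') (hα : 0 ≤ α₁) : 0 ≤ kappaAvKnit d ℓ N b₁' ϱ' α₁ δ := by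
  unfold kappaAvKnit; positivity

variable (i : KIdx d ℓ hd hL b₀ b₁) (q : ↥(cubes (toKT i).D.toDomains))

/-- **THE WEIGHT OF AN INDEX BOND IN THE LEVEL WINDOW OF A BLOCK OF LEVEL `n`**: `n ≤ J(ι) ≤ n + 1 ⟹ w_□(ι) ≤ b₁·(c_f∕Lⁿ)²·(L^{d+1})^{n+1}` (r05's `wCubeBond_le` against the
window; the step inside r05's `norm_avgPiece_liftY_apply_le`, named). [cite: Balaban1984PropagatorsII, (2.16) p.225, (2.20) p.226, (2.2)–(2.4) p.224] -/
theorem wCubeBond_le_window (hb₀ : 0 < b₀) (hb₁ : b₀ ≤ b₁) (ι : IBondCubeY i q) {n : ℕ} (hJ1 : n ≤ (ι.1.1 : ℕ)) (hJ2 : (ι.1.1 : ℕ) ≤ n + 1) :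
    wCubeBond i q ι ≤ b₁ * (i.cf / (((ℓ + 1 : ℕ) : ℝ)) ^ n) ^ 2 * ((((ℓ + 1 : ℕ) : ℝ)) ^ (d + 1)) ^ (n + 1) := by
  set L : ℝ := ((ℓ + 1 : ℕ) : ℝ) with hLdef
  have hL1 : (1 : ℝ) ≤ L := by rw [hLdef]; exact_mod_cast Nat.succ_le_succ (Nat.zero_le ℓ)
  have hL0 : (0 : ℝ) < L := lt_of_lt_of_le one_pos hL1
  have hb1 : 0 ≤ b₁ := hb₀.le.trans hb₁
  have hw := wCubeBond_le i q hb₁ ι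
  have hsq : (i.cf / L ^ (ι.1.1 : ℕ)) ^ 2 ≤ (i.cf / L ^ n) ^ 2 := by
    rw [div_pow, div_pow]
    exact div_le_div_of_nonneg_left (sq_nonneg _) (by positivity) (pow_le_pow_left₀ (by positivity) (pow_le_pow_right₀ hL1 hJ1) 2)
  have hpl : (L ^ (d + 1)) ^ (ι.1.1 : ℕ) ≤ (L ^ (d + 1)) ^ (n + 1) := pow_le_pow_right₀ (one_le_pow₀ hL1) hJ2
  refine hw.trans ?_
  exact mul_le_mul (mul_le_mul_of_nonneg_left hsq hb1) hpl (by positivity) (by positivity)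

end Constants

/-! ## §2 (3.83) at the knit pair of the cube sequence, pointwise on product inputs -/

section Pointwise

open scoped Matrix Matrix.Norms.L2Operator

variable {N : ℕ} [Nonempty (Fin N)] (i : KIdx d ℓ hd hL b₀ b₁) (q : ↥(cubes (toKT i).D.toDomains))
  -- the (3.35) parameter at the base `U = 1` (free) and the x-free numerics of the (3.80) engine ([5] Props. 5–7 windows)
  {α₀ : ℝ} (hα₀ : 0 < α₀) (hMα : 0 ≤ (kGeo i).M * α₀)
  {α₀' : ℝ} (hα' : 0 < α₀') (hα3 : C0 (d + 1) * α₀' ≤ 1 / 3) (hα8 : 8 * α₀' ≤ c2' (d + 1) (ℓ + 1))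
  (hK : Kpl i ((kGeo i).M * α₀) * (kGeo i).L ^ 4 < α₀')
  {ϱ' ϱ : ℝ} (hϱ' : 0 < ϱ') (hϱ : 0 < ϱ)
  (hsmall' : Real.exp (4 * (800 * (((d + 1 : ℕ) : ℝ) + 1) ^ 2 * (((d + 1 : ℕ) : ℝ) + 4)) * α₀')
    * (1 + 8 * (131072 * (((d + 1 : ℕ) : ℝ) + 1) ^ 2) * ϱ') ≤ 2)
  (hc₃' : 2 * ϱ' ≤ c3 (d + 1) (ℓ + 1)) (hϱ'1 : 409600 * (((d + 1 : ℕ) : ℝ) + 1) ^ 2 * ϱ' ≤ 1)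
  (hE : epsCplx (d + 1) (ℓ + 1) ϱ' 0 ≤ 1 / 16)
  (hdX : ((d + 1 : ℕ) : ℝ) * (epsCplx (d + 1) (ℓ + 1) ϱ' 0 + tauCplx (d + 1) (ℓ + 1) α₀' 0 ϱ' 0) ≤ 1 / 16)
  (hsmall : Real.exp (4480 * (((d + 1 : ℕ) : ℝ) + 1) ^ 2 * (((d + 1 : ℕ) : ℝ) + 4) * α₀' + 240000 * (((d + 1 : ℕ) : ℝ) + 1) ^ 3 * ϱ')
    * (1 + 8 * (2097152 * (((d + 1 : ℕ) : ℝ) + 1) ^ 2) * ϱ) ≤ 2)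
  (hc₃ : 2 * ϱ ≤ c3 (d + 1) (ℓ + 1) / 4)
  -- the perturbation: print's (3.37) smallness on the end blocks of every index bond of the cube sequence
  (a : Fin (d + 1) → Site (PV d ℓ i.m i.K hd hL) 0 → Matrix (Fin N) (Fin N) ℂ) {α₁ : ℝ} (hα₁ : 0 ≤ α₁) (hα₁ϱ : 3 * α₁ ≤ ϱ')
  (ha : ∀ (ι : IBondCubeY i q) (μ : Fin (d + 1)) (x : Site (PV d ℓ i.m i.K hd hL) 0),
    iterBlockOf (ι.1.1 : ℕ) x = ι.1.2.src ∨ iterBlockOf (ι.1.1 : ℕ) x = ι.1.2.tgt →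
      (((ℓ + 1 : ℕ) : ℝ)) ^ (ι.1.1 : ℕ) * (kGeo i).eta * ‖a μ x‖ ≤ α₁)

include hα₀ hMα hα' hα3 hα8 hK hϱ' hϱ hsmall' hc₃' hϱ'1 hE hdX hsmall hc₃ hα₁ hα₁ϱ ha in
/-- ★ **THE F₂ ROW KERNEL OF THE KNIT PAIR AT THE BASE `U = 1`**: `‖(Q_□(e^{iηa}·1)Λ)(ι) − (Q_□(1)Λ)(ι)‖ ≤ Σ_f ((9∕(2ϱ′))·α₁·boxKP i ι.1 f)·‖Λ f‖` — the g39 engine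
`norm_QknitCubeY_mulY_sub_apply_le` at `U := 1` ∈ (3.35) (`reg335P_one`) with the gauge group `U(N)` (`unitaryUnits_le_U1`).
[cite: Balaban1985BackgroundPropagators, (3.80)–(3.81) p.406, Cor. 3.5 p.407 («U = 1»), p.409 l.1–5; Balaban1985Averaging, Proposition 7 p.43] -/
theorem norm_QknitCubeY_fluct_sub_one_apply_le (Λ : FBondY i → Matrix (Fin N) (Fin N) ℂ) (ι : IBondCubeY i q) :
    ‖QknitCubeY i q (fun μ x => fluct (kGeo i).eta a μ x * 1) Λ ι - QknitCubeY i q (fun _ _ => 1) Λ ι‖ ≤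
      ∑ f, (9 / (2 * ϱ') * α₁ * boxKP i ι.1 f) * ‖Λ f‖ := by
  letI : CStarAlgebra (Matrix (Fin N) (Fin N) ℂ) := {}
  have hG1 : ∀ u : (Matrix (Fin N) (Fin N) ℂ)ˣ, u ∈ unitaryUnits (Matrix (Fin N) (Fin N) ℂ) → ‖(u : Matrix (Fin N) (Fin N) ℂ)‖ ≤ 1 :=
    fun u hu => (B7Prop1Explicit.mem_U1.1 (unitaryUnits_le_U1 hu)).1
  have hreg : (bg9KP (Matrix (Fin N) (Fin N) ℂ) (unitaryUnits (Matrix (Fin N) (Fin N) ℂ)) i).Reg335 10 α₀ (fun _ _ => 1) :=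
    reg335P_one i 10 hα₀
  have h := norm_QknitCubeY_mulY_sub_apply_le i hG1 le_rfl (le_refl (10 : ℝ)) hMα hreg hα' hα3 hα8 hK hϱ' hϱ hsmall' hc₃' hϱ'1 hE hdX hsmall hc₃ a hα₁
    hα₁ϱ q ι (ha ι) Λ
  refine h.trans (le_of_eq ?_)
  rw [Finset.mul_sum]
  exact Finset.sum_congr rfl fun f _ => by ring

include hα₀ hMα hα' hα3 hα8 hK hϱ' hϱ hsmall' hc₃' hϱ'1 hE hdX hsmall hc₃ hα₁ hα₁ϱ ha in
/-- ★★★ **(3.83) AT THE KNIT PAIR AS A BLOCK BOUND ON PRODUCT INPUTS** — the reading behind the block majorant: at the base `U = 1` and the perturbation `Ṽ = e^{iηa}·1` with the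
level-by-level smallness `Lʲη‖a‖ ≤ α₁` on the end blocks of every index bond of `{Ω_n(□)}`, for an input `g ⊗ E` supported in the cube block `y′` with `|g| ≤ B`, `‖E‖ ≤ 1`, and
any `δ ≥ 0`: `‖((Q*_□(Ṽ)a_□Q_□(Ṽ) − Q*_□(1)a_□Q_□(1))(g ⊗ E))(b)‖ ≤ κ·α₁·((Lⁿη)²)⁻¹·e^{−δ·d(y(b), y′)}·B`, `n` the level of the cube block `y(b)`.  Three terms of (3.82)
(`F₂*·a_□Q_□(1)`, `Q*_□(1)·a_□F₂`, `F₂*·a_□F₂`): rows of `F₂` (§2 `…fluct_sub_one…`), columns of `F₂* = adjTrY F₂` and of `Q*_□(1) = (qsKc)♯` (part 1), weights in the level window,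
column masses `4(d+1)L^{−n(d+1)}` ∕ `2L^{−n(d+1)}`, locality `e^{δ(2ℓ+6)}e^{−δd} ≥ 1` on the double support.
[cite: Balaban1985BackgroundPropagators, (3.82)–(3.83) p.407, (3.80)–(3.81) p.406, (3.37) p.396, p.409 l.1–5; Balaban1984PropagatorsII, (2.51) p.232] -/
theorem norm_avgPieceKnit_liftY_apply_le (hb₀ : 0 < b₀) (hb₁ : b₀ ≤ b₁) {δ : ℝ} (hδ : 0 ≤ δ)
    (g : FBondY i → ℝ) (E : Matrix (Fin N) (Fin N) ℂ) (y' : BlkCubeY i q) {B : ℝ} (hE1 : ‖E‖ ≤ 1) (hB : 0 ≤ B)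
    (hoff : ∀ f, blkV1 i.hN (cubeFamY i q) f ≠ y' → g f = 0) (hbd : ∀ f, |g f| ≤ B) (bb : FBondY i) :
    ‖(QsknitCubeY i q (fun μ x => fluct (kGeo i).eta a μ x * 1) (aCubeY i q (QknitCubeY i q (fun μ x => fluct (kGeo i).eta a μ x * 1) (liftY g E))) -
        QsknitCubeY i q (fun _ _ => 1) (aCubeY i q (QknitCubeY i q (fun _ _ => 1) (liftY g E)))) bb‖ ≤
      kappaAvKnit d ℓ N b₁ ϱ' α₁ δ * α₁ * ((geoCK i q).len (blkV1 i.hN (cubeFamY i q) bb) ^ 2)⁻¹ *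
        Real.exp (-(δ * (geoCK i q).dist (blkV1 i.hN (cubeFamY i q) bb) y')) * B := by
  -- the external facts at `bb` (column masses, the squared length), fetched BEFORE the abbreviations below so that `set` rewrites them syntactically
  have hcolB := sum_boxKP_col_le_plateau i q bb
  have hcolQ := sum_qKc_col_le_plateau i q bb
  have hlen := (cf_div_pow_sq i q (blkV1 i.hN (cubeFamY i q) bb)).symm
  set Vt : CfgY (Matrix (Fin N) (Fin N) ℂ) i := fun μ x => fluct (kGeo i).eta a μ x * 1 with hVt
  set ab := blkV1 i.hN (cubeFamY i q) bb with hab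
  set n : ℕ := ab.1.1 with hn
  set L : ℝ := ((ℓ + 1 : ℕ) : ℝ) with hLdef
  have hL1 : (1 : ℝ) ≤ L := by rw [hLdef]; exact_mod_cast Nat.succ_le_succ (Nat.zero_le ℓ)
  have hL0 : (0 : ℝ) < L := lt_of_lt_of_le one_pos hL1
  have hb1 : 0 ≤ b₁ := hb₀.le.trans hb₁
  set C : ℝ := 9 / (2 * ϱ') * α₁ with hC
  have hC0 : 0 ≤ C := by positivity
  -- the locality factor, the window weight, the plateau
  set X : ℝ := Real.exp (δ * (2 * (ℓ : ℝ) + 6)) * Real.exp (-(δ * (geoCK i q).dist ab y')) with hX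
  have hX0 : 0 ≤ X := by positivity
  set Wn : ℝ := b₁ * (i.cf / L ^ n) ^ 2 * (L ^ (d + 1)) ^ (n + 1) with hWn
  have hWn0 : 0 ≤ Wn := by positivity
  set vn : ℝ := ((L ^ (d + 1)) ^ n)⁻¹ with hvn
  have hvn0 : 0 ≤ vn := by positivity
  -- the amplitude of the product input
  have hΛB : ∀ f, ‖liftY g E f‖ ≤ B := by
    intro f
    rw [liftY_apply, norm_smul, Complex.norm_real, Real.norm_eq_abs]
    calc |g f| * ‖E‖ ≤ B * 1 := mul_le_mul (hbd f) hE1 (norm_nonneg _) hB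
      _ = B := mul_one B
  have hΛ0 : ∀ f, blkV1 i.hN (cubeFamY i q) f ≠ y' → liftY g E f = 0 := by
    intro f hf
    rw [liftY_apply, hoff f hf, Complex.ofReal_zero, zero_smul]
  -- KEY: a kernel entry supported on the ends of an index bond `ι` that sees `bb` weighs `‖(g ⊗ E)(f)‖` by at most `B·X` (locality of the double support)
  have hkey : ∀ ι : IBondCubeY i q, (iterBlockOf (ι.1.1 : ℕ) bb.src = ι.1.2.src ∨ iterBlockOf (ι.1.1 : ℕ) bb.src = ι.1.2.tgt) →
      ∀ (f : FBondY i) (kf : ℝ), 0 ≤ kf →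
        (kf ≠ 0 → (iterBlockOf (ι.1.1 : ℕ) f.src = ι.1.2.src ∨ iterBlockOf (ι.1.1 : ℕ) f.src = ι.1.2.tgt)) →
          kf * ‖liftY g E f‖ ≤ kf * (B * X) := by
    intro ι hbb f kf hkf hsupp
    by_cases hk : kf = 0
    · rw [hk, zero_mul, zero_mul]
    refine mul_le_mul_of_nonneg_left ?_ hkf
    by_cases hfy : blkV1 i.hN (cubeFamY i q) f = y'
    · have hdist : (geoCK i q).dist ab y' ≤ 2 * (ℓ : ℝ) + 6 := by
        rw [← hfy]; exact dist_blkV1_le_of_ends_ends i q hbb (hsupp hk)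
      have hX1 : 1 ≤ X := by
        rw [hX, ← Real.exp_add]
        exact Real.one_le_exp (by nlinarith)
      calc ‖liftY g E f‖ ≤ B := hΛB f
        _ = B * 1 := (mul_one B).symm
        _ ≤ B * X := mul_le_mul_of_nonneg_left hX1 hB
    · rw [hΛ0 f hfy, norm_zero]; positivity
  -- the weight of an index bond seeing `bb` (level window at `bb`)
  have hW : ∀ ι : IBondCubeY i q, (iterBlockOf (ι.1.1 : ℕ) bb.src = ι.1.2.src ∨ iterBlockOf (ι.1.1 : ℕ) bb.src = ι.1.2.tgt) → wCubeBond i q ι ≤ Wn := by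
    intro ι hbb
    have hw := lvl_window_of_ends i q hbb
    rw [← hab, ← hn] at hw
    have hJ2 : (ι.1.1 : ℕ) ≤ n + 1 := by omega
    have h := wCubeBond_le_window i q hb₀ hb₁ ι hw.2 hJ2
    rw [← hLdef] at h
    exact h
  -- the rows of `Q_□(1) = (qKc)♯` and of `F₂ = Q_□(Ṽ) − Q_□(1)`
  have hrow1 : ∀ (Λ' : FBondY i → Matrix (Fin N) (Fin N) ℂ) (ι : IBondCubeY i q), ‖QknitCubeY i q (fun _ _ => 1) Λ' ι‖ ≤ ∑ f, qKc i q ι f * ‖Λ' f‖ := by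
    intro Λ' ι
    rw [QknitCubeY_one_liftMatY]
    exact (norm_liftMatY_apply_le _ _ _).trans (le_of_eq (Finset.sum_congr rfl fun f _ => by rw [abs_of_nonneg (qKc_nonneg i q ι f)]))
  have hrowF : ∀ (Λ' : FBondY i → Matrix (Fin N) (Fin N) ℂ) (ι : IBondCubeY i q),
      ‖QknitCubeY i q Vt Λ' ι - QknitCubeY i q (fun _ _ => 1) Λ' ι‖ ≤ ∑ f, (C * boxKP i ι.1 f) * ‖Λ' f‖ :=
    fun Λ' ι => norm_QknitCubeY_fluct_sub_one_apply_le i q hα₀ hMα hα' hα3 hα8 hK hϱ' hϱ hsmall' hc₃' hϱ'1 hE hdX hsmall hc₃ a hα₁ hα₁ϱ ha Λ' ι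
  -- the two averaged inputs `X₀ = a_□Q_□(1)(g ⊗ E)`, `X₁ = a_□Q_□(Ṽ)(g ⊗ E)` and their sizes on the index bonds seeing `bb`
  set X₀ : IBondCubeY i q → Matrix (Fin N) (Fin N) ℂ := aCubeY i q (QknitCubeY i q (fun _ _ => 1) (liftY g E)) with hX₀
  set X₁ : IBondCubeY i q → Matrix (Fin N) (Fin N) ℂ := aCubeY i q (QknitCubeY i q Vt (liftY g E)) with hX₁
  have hX10 : X₁ - X₀ = aCubeY i q (QknitCubeY i q Vt (liftY g E) - QknitCubeY i q (fun _ _ => 1) (liftY g E)) := by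
    rw [hX₁, hX₀, map_sub]
  have hE0 : ∀ ι : IBondCubeY i q, (iterBlockOf (ι.1.1 : ℕ) bb.src = ι.1.2.src ∨ iterBlockOf (ι.1.1 : ℕ) bb.src = ι.1.2.tgt) →
      ‖X₀ ι‖ ≤ Wn * (B * X) := by
    intro ι hbb
    rw [hX₀, norm_aCubeY_apply i q hb₀]
    have h1 : ‖QknitCubeY i q (fun _ _ => 1) (liftY g E) ι‖ ≤ B * X := by
      refine (hrow1 _ ι).trans ?_
      calc ∑ f, qKc i q ι f * ‖liftY g E f‖ ≤ ∑ f, qKc i q ι f * (B * X) :=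
            Finset.sum_le_sum fun f _ => hkey ι hbb f _ (qKc_nonneg i q ι f) (fun h => ends_of_qKc_ne_zero i q h)
        _ = B * X := by rw [← Finset.sum_mul, sum_qKc_eq_one, one_mul]
    exact mul_le_mul (hW ι hbb) h1 (norm_nonneg _) hWn0
  have hE1 : ∀ ι : IBondCubeY i q, (iterBlockOf (ι.1.1 : ℕ) bb.src = ι.1.2.src ∨ iterBlockOf (ι.1.1 : ℕ) bb.src = ι.1.2.tgt) →
      ‖(X₁ - X₀) ι‖ ≤ Wn * (C * (2 * ((d : ℝ) + 1)) * (B * X)) := by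
    intro ι hbb
    rw [hX10, norm_aCubeY_apply i q hb₀]
    have h1 : ‖(QknitCubeY i q Vt (liftY g E) - QknitCubeY i q (fun _ _ => 1) (liftY g E)) ι‖ ≤ C * (2 * ((d : ℝ) + 1)) * (B * X) := by
      rw [Pi.sub_apply]
      refine (hrowF _ ι).trans ?_
      calc ∑ f, C * boxKP i ι.1 f * ‖liftY g E f‖ ≤ ∑ f, C * boxKP i ι.1 f * (B * X) :=
            Finset.sum_le_sum fun f _ => hkey ι hbb f _ (mul_nonneg hC0 (boxKP_nonneg i ι.1 f))
              (fun h => ends_of_boxKP_ne_zero i ι.1 (fun h0 => h (by rw [h0, mul_zero])))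
        _ = C * (B * X) * ∑ f, boxKP i ι.1 f := by rw [Finset.mul_sum]; exact Finset.sum_congr rfl fun f _ => by ring
        _ ≤ C * (B * X) * (2 * ((d : ℝ) + 1)) := mul_le_mul_of_nonneg_left (sum_boxKP_le i ι.1) (by positivity)
        _ = C * (2 * ((d : ℝ) + 1)) * (B * X) := by ring
    exact mul_le_mul (hW ι hbb) h1 (norm_nonneg _) hWn0
  -- the three terms of (3.82)
  have hsplit := apply_sub_apply_eq_three_terms (QsknitCubeY i q (fun _ _ => 1)) (QsknitCubeY i q Vt) X₀ X₁
  have happ := congrArg (fun G : FBondY i → Matrix (Fin N) (Fin N) ℂ => G bb) hsplit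
  simp only [Pi.add_apply, Pi.sub_apply] at happ
  -- T1 = `F₂*·(a_□Q_□(1)(g ⊗ E))`
  have hT1 : ‖QsknitCubeY i q Vt X₀ bb - QsknitCubeY i q (fun _ _ => 1) X₀ bb‖ ≤ (N : ℝ) ^ 4 * (C * (Wn * (B * X)) * (4 * ((d : ℝ) + 1) * vn)) := by
    have e := norm_QsknitCubeY_sub_one_apply_le_of_rowKernel i q Vt (fun ι f => C * boxKP i ι.1 f) (fun ι f => mul_nonneg hC0 (boxKP_nonneg i ι.1 f))
      hrowF X₀ bb
    beta_reduce at e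
    refine e.trans (mul_le_mul_of_nonneg_left ?_ (by positivity))
    calc ∑ ι, C * boxKP i ι.1 bb * ‖X₀ ι‖ ≤ ∑ ι : IBondCubeY i q, C * boxKP i ι.1 bb * (Wn * (B * X)) := by
          refine Finset.sum_le_sum fun ι _ => ?_
          by_cases hι : boxKP i ι.1 bb = 0
          · rw [hι, mul_zero, zero_mul, zero_mul]
          · exact mul_le_mul_of_nonneg_left (hE0 ι (ends_of_boxKP_ne_zero i ι.1 hι)) (mul_nonneg hC0 (boxKP_nonneg i ι.1 bb))
      _ = C * (Wn * (B * X)) * ∑ ι : IBondCubeY i q, boxKP i ι.1 bb := by rw [Finset.mul_sum]; exact Finset.sum_congr rfl fun ι _ => by ring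
      _ ≤ C * (Wn * (B * X)) * (4 * ((d : ℝ) + 1) * vn) := mul_le_mul_of_nonneg_left hcolB (by positivity)
  -- T2 = `Q*_□(1)·(a_□F₂(g ⊗ E))`
  have hT2 : ‖QsknitCubeY i q (fun _ _ => 1) (X₁ - X₀) bb‖ ≤ Wn * (C * (2 * ((d : ℝ) + 1)) * (B * X)) * (2 * vn) := by
    refine (norm_QsknitCubeY_one_apply_le i q (X₁ - X₀) bb).trans ?_
    calc ∑ ι, qKc i q ι bb * ‖(X₁ - X₀) ι‖ ≤ ∑ ι, qKc i q ι bb * (Wn * (C * (2 * ((d : ℝ) + 1)) * (B * X))) := by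
          refine Finset.sum_le_sum fun ι _ => ?_
          by_cases hι : qKc i q ι bb = 0
          · rw [hι, zero_mul, zero_mul]
          · exact mul_le_mul_of_nonneg_left (hE1 ι (ends_of_qKc_ne_zero i q hι)) (qKc_nonneg i q ι bb)
      _ = Wn * (C * (2 * ((d : ℝ) + 1)) * (B * X)) * ∑ ι, qKc i q ι bb := by
          rw [Finset.mul_sum]; exact Finset.sum_congr rfl fun ι _ => by ring
      _ ≤ Wn * (C * (2 * ((d : ℝ) + 1)) * (B * X)) * (2 * vn) := mul_le_mul_of_nonneg_left hcolQ (by positivity)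
  -- T3 = `F₂*·(a_□F₂(g ⊗ E))`
  have hT3 : ‖QsknitCubeY i q Vt (X₁ - X₀) bb - QsknitCubeY i q (fun _ _ => 1) (X₁ - X₀) bb‖ ≤
      (N : ℝ) ^ 4 * (C * (Wn * (C * (2 * ((d : ℝ) + 1)) * (B * X))) * (4 * ((d : ℝ) + 1) * vn)) := by
    have e := norm_QsknitCubeY_sub_one_apply_le_of_rowKernel i q Vt (fun ι f => C * boxKP i ι.1 f) (fun ι f => mul_nonneg hC0 (boxKP_nonneg i ι.1 f))
      hrowF (X₁ - X₀) bb
    beta_reduce at e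
    refine e.trans (mul_le_mul_of_nonneg_left ?_ (by positivity))
    calc ∑ ι, C * boxKP i ι.1 bb * ‖(X₁ - X₀) ι‖ ≤ ∑ ι : IBondCubeY i q, C * boxKP i ι.1 bb * (Wn * (C * (2 * ((d : ℝ) + 1)) * (B * X))) := by
          refine Finset.sum_le_sum fun ι _ => ?_
          by_cases hι : boxKP i ι.1 bb = 0
          · rw [hι, mul_zero, zero_mul, zero_mul]
          · exact mul_le_mul_of_nonneg_left (hE1 ι (ends_of_boxKP_ne_zero i ι.1 hι)) (mul_nonneg hC0 (boxKP_nonneg i ι.1 bb))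
      _ = C * (Wn * (C * (2 * ((d : ℝ) + 1)) * (B * X))) * ∑ ι : IBondCubeY i q, boxKP i ι.1 bb := by
          rw [Finset.mul_sum]; exact Finset.sum_congr rfl fun ι _ => by ring
      _ ≤ C * (Wn * (C * (2 * ((d : ℝ) + 1)) * (B * X))) * (4 * ((d : ℝ) + 1) * vn) :=
          mul_le_mul_of_nonneg_left hcolB (by positivity)
  -- assemble
  have hgoal : QsknitCubeY i q Vt X₁ bb - QsknitCubeY i q (fun _ _ => 1) X₀ bb =
      (QsknitCubeY i q Vt X₀ bb - QsknitCubeY i q (fun _ _ => 1) X₀ bb) + QsknitCubeY i q (fun _ _ => 1) (X₁ - X₀) bb +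
        (QsknitCubeY i q Vt (X₁ - X₀) bb - QsknitCubeY i q (fun _ _ => 1) (X₁ - X₀) bb) := happ
  rw [Pi.sub_apply, hgoal]
  refine (norm_add_le _ _).trans ((add_le_add (norm_add_le _ _) le_rfl).trans ?_)
  calc ‖QsknitCubeY i q Vt X₀ bb - QsknitCubeY i q (fun _ _ => 1) X₀ bb‖ + ‖QsknitCubeY i q (fun _ _ => 1) (X₁ - X₀) bb‖ +
        ‖QsknitCubeY i q Vt (X₁ - X₀) bb - QsknitCubeY i q (fun _ _ => 1) (X₁ - X₀) bb‖
      ≤ (N : ℝ) ^ 4 * (C * (Wn * (B * X)) * (4 * ((d : ℝ) + 1) * vn)) + Wn * (C * (2 * ((d : ℝ) + 1)) * (B * X)) * (2 * vn) +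
          (N : ℝ) ^ 4 * (C * (Wn * (C * (2 * ((d : ℝ) + 1)) * (B * X))) * (4 * ((d : ℝ) + 1) * vn)) := add_le_add (add_le_add hT1 hT2) hT3
    _ = kappaAvKnit d ℓ N b₁ ϱ' α₁ δ * α₁ * ((geoCK i q).len ab ^ 2)⁻¹ * Real.exp (-(δ * (geoCK i q).dist ab y')) * B := by
        rw [hWn, hvn, hX, hC, kappaAvKnit, hlen, ← hLdef, pow_succ]
        have hLn : (L ^ (d + 1)) ^ n ≠ 0 := by positivity
        have hLd : L ^ (d + 1) ≠ 0 := by positivity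
        have hϱ0 : ϱ' ≠ 0 := hϱ'.ne'
        field_simp
        ring

end Pointwise

/-! ## §3 ★★★ The block majorant of the knit averaging piece — dag-n06-c's `hAv` at the letter of record -/

section Majorant

open scoped Matrix Matrix.Norms.L2Operator

variable {N : ℕ} [Nonempty (Fin N)] {ιb : Type} [Fintype ιb] (b : Module.Basis ιb ℝ (Matrix (Fin N) (Fin N) ℂ))
  (i : KIdx d ℓ hd hL b₀ b₁) (q : ↥(cubes (toKT i).D.toDomains))
  {α₀ : ℝ} (hα₀ : 0 < α₀) (hMα : 0 ≤ (kGeo i).M * α₀)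
  {α₀' : ℝ} (hα' : 0 < α₀') (hα3 : C0 (d + 1) * α₀' ≤ 1 / 3) (hα8 : 8 * α₀' ≤ c2' (d + 1) (ℓ + 1))
  (hK : Kpl i ((kGeo i).M * α₀) * (kGeo i).L ^ 4 < α₀')
  {ϱ' ϱ : ℝ} (hϱ' : 0 < ϱ') (hϱ : 0 < ϱ)
  (hsmall' : Real.exp (4 * (800 * (((d + 1 : ℕ) : ℝ) + 1) ^ 2 * (((d + 1 : ℕ) : ℝ) + 4)) * α₀')
    * (1 + 8 * (131072 * (((d + 1 : ℕ) : ℝ) + 1) ^ 2) * ϱ') ≤ 2)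
  (hc₃' : 2 * ϱ' ≤ c3 (d + 1) (ℓ + 1)) (hϱ'1 : 409600 * (((d + 1 : ℕ) : ℝ) + 1) ^ 2 * ϱ' ≤ 1)
  (hE : epsCplx (d + 1) (ℓ + 1) ϱ' 0 ≤ 1 / 16)
  (hdX : ((d + 1 : ℕ) : ℝ) * (epsCplx (d + 1) (ℓ + 1) ϱ' 0 + tauCplx (d + 1) (ℓ + 1) α₀' 0 ϱ' 0) ≤ 1 / 16)
  (hsmall : Real.exp (4480 * (((d + 1 : ℕ) : ℝ) + 1) ^ 2 * (((d + 1 : ℕ) : ℝ) + 4) * α₀' + 240000 * (((d + 1 : ℕ) : ℝ) + 1) ^ 3 * ϱ')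
    * (1 + 8 * (2097152 * (((d + 1 : ℕ) : ℝ) + 1) ^ 2) * ϱ) ≤ 2)
  (hc₃ : 2 * ϱ ≤ c3 (d + 1) (ℓ + 1) / 4)
  {M₂ : ℝ} (hM₂ : 0 ≤ M₂) (hrepr : ∀ (v : Matrix (Fin N) (Fin N) ℂ) (j : ιb), |b.repr v j| ≤ M₂ * ‖v‖)
  (hb₀ : 0 < b₀) (hb₁ : b₀ ≤ b₁)

include hα₀ hMα hα' hα3 hα8 hK hϱ' hϱ hsmall' hc₃' hϱ'1 hE hdX hsmall hc₃ hM₂ hrepr hb₀ hb₁ in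
/-- ★★★ **THE BLOCK MAJORANT OF THE KNIT AVERAGING PIECE — dag-n06-c's `hAv` AT THE LETTER OF RECORD, VERBATIM SHAPE** ((3.83) in [4]'s (2.51) currency over the cube
sequence's blocks, real coordinates): for a perturbation `Ṽ` with `Ṽ_μ(x) = e^{iηa_μ(x)}` (hypothesis `hV`) whose exponent obeys print's (3.37) smallness `Lʲη‖a_μ(x)‖ ≤ α₁` on the
two end blocks of every index bond of `{Ω_n(□)}` (`3α₁ ≤ ϱ′`), the x-free numerics of [5] Props. 5–7, the weight band and the basis constant `M₂`, and every `δ ≥ 0`: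
`avgPieceCKnit b i □ Ṽ = conj b((Q*_□(1)a_□Q_□(1) − Q*_□(Ṽ)a_□Q_□(Ṽ))♯ℝ) ≺ ((M₂Σ_j‖b_j‖)·κ)·α₁·(len²)⁻¹·e^{−δd}` over `toB6 (geoCK i □) Rr H` with the bond block map `blkBK i □`
— the `P₂`-SHAPED input `κ₂α₁(len)⁻²e^{−δd}` of `h385_dirB_of_pieces` with `κ₂ := (M₂Σ_j‖b_j‖)·kappaAvKnit d ℓ N b₁ ϱ′ α₁ δ`.
[cite: Balaban1985BackgroundPropagators, (3.83) p.407, (3.85) p.407, (3.80)–(3.82) pp.406–407, (3.26) p.395, p.409 l.1–5; Balaban1984PropagatorsII, (2.51) p.232; Balaban1985Averaging, Proposition 7 p.43] -/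
theorem hasMajorant_avgPieceCKnit
    (a : Fin (d + 1) → Site (PV d ℓ i.m i.K hd hL) 0 → Matrix (Fin N) (Fin N) ℂ) {α₁ : ℝ} (hα₁ : 0 ≤ α₁) (hα₁ϱ : 3 * α₁ ≤ ϱ')
    (ha : ∀ (ι : IBondCubeY i q) (μ : Fin (d + 1)) (x : Site (PV d ℓ i.m i.K hd hL) 0),
      iterBlockOf (ι.1.1 : ℕ) x = ι.1.2.src ∨ iterBlockOf (ι.1.1 : ℕ) x = ι.1.2.tgt →
        (((ℓ + 1 : ℕ) : ℝ)) ^ (ι.1.1 : ℕ) * (kGeo i).eta * ‖a μ x‖ ≤ α₁)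
    (V : CfgY (Matrix (Fin N) (Fin N) ℂ) i) (hV : ∀ μ x, V μ x = fluct (kGeo i).eta a μ x)
    {δ : ℝ} (hδ : 0 ≤ δ) (Rr : ℝ) (H : Prop) :
    HasMajorant (g := toB6 (geoCK i q) Rr H) (blkBK i q) (avgPieceCKnit b i q V)
      (fun y y₁ => ((M₂ * ∑ j, ‖b j‖) * kappaAvKnit d ℓ N b₁ ϱ' α₁ δ) * α₁ * ((geoCK i q).len y ^ 2)⁻¹ * Real.exp (-(δ * (geoCK i q).dist y y₁))) := by
  have eV : V = fun μ x => fluct (kGeo i).eta a μ x * 1 := by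
    funext μ x; rw [hV, mul_one]
  rw [eV]
  show HasMajorant (g := toB6 (geoCK i q) Rr H) (blkBK i q)
    (conj b ((QsknitCubeY i q 1 ∘ₗ aCubeY i q ∘ₗ QknitCubeY i q 1 -
      QsknitCubeY i q (fun μ x => fluct (kGeo i).eta a μ x * 1) ∘ₗ aCubeY i q ∘ₗ
        QknitCubeY i q (fun μ x => fluct (kGeo i).eta a μ x * 1)).restrictScalars ℝ)) _
  have h := hasMajorant_conj_of_liftY_bound b (g := toB6 (geoCK i q) Rr H) (fun f : FBondY i => blkV1 i.hN (cubeFamY i q) f)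
    ((QsknitCubeY i q 1 ∘ₗ aCubeY i q ∘ₗ QknitCubeY i q 1 -
      QsknitCubeY i q (fun μ x => fluct (kGeo i).eta a μ x * 1) ∘ₗ aCubeY i q ∘ₗ
        QknitCubeY i q (fun μ x => fluct (kGeo i).eta a μ x * 1)).restrictScalars ℝ)
    (fun y y₁ => kappaAvKnit d ℓ N b₁ ϱ' α₁ δ * α₁ * ((geoCK i q).len y ^ 2)⁻¹ * Real.exp (-(δ * (geoCK i q).dist y y₁))) M₂ hM₂ hrepr
    (fun g E y' B hE' hB hoff hbd bb => by
      have h := norm_avgPieceKnit_liftY_apply_le i q hα₀ hMα hα' hα3 hα8 hK hϱ' hϱ hsmall' hc₃' hϱ'1 hE hdX hsmall hc₃ a hα₁ hα₁ϱ ha hb₀ hb₁ hδ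
        g E y' hE' hB hoff hbd bb
      have e1 : (1 : CfgY (Matrix (Fin N) (Fin N) ℂ) i) = fun _ _ => 1 := rfl
      rw [LinearMap.restrictScalars_apply, LinearMap.sub_apply, LinearMap.comp_apply, LinearMap.comp_apply, LinearMap.comp_apply, LinearMap.comp_apply,
        ← neg_sub, Pi.neg_apply, norm_neg, e1]
      exact h)
  exact hasMajorant_mono _ h (fun y y₁ => le_of_eq (by ring))

include hα₀ hMα hα' hα3 hα8 hK hϱ' hϱ hsmall' hc₃' hϱ'1 hE hdX hsmall hc₃ hM₂ hrepr hb₀ hb₁ in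
/-- ★★ **THE SAME WITH THE END-BLOCK LAW FROM r06's NESTED CLASS (3.37)** (`Cplx337 … (levV1 i) α₁ a`: «|A| < α₁(Lʲη)⁻¹ on Ω_j» at the MEMBER's levels): on the end blocks of a
cube-sequence index bond of level `j` the fine sites have member level `≥ j − 1`, so `Lʲη‖a‖ ≤ L·α₁` (✓`endBlock_small_of_cplx337_cube`) — the majorant with `α₁ ↦ L·α₁`
(«a constant depending on d and L»), under `3Lα₁ ≤ ϱ′`. [cite: Balaban1985BackgroundPropagators, (3.37) p.396, (3.83) p.407, p.406 (before (3.79)); Balaban1984PropagatorsII, (2.2)–(2.4) p.224, (2.51) p.232] -/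
theorem hasMajorant_avgPieceCKnit_of_cplx337 {U : CfgY (Matrix (Fin N) (Fin N) ℂ) i}
    (a : Fin (d + 1) → Site (PV d ℓ i.m i.K hd hL) 0 → Matrix (Fin N) (Fin N) ℂ) {α₁ : ℝ} (hα₁ : 0 ≤ α₁)
    (hα₁ϱ : 3 * ((((ℓ + 1 : ℕ) : ℝ)) * α₁) ≤ ϱ')
    (h37 : Cplx337 (shiftsV1 (PV d ℓ i.m i.K hd hL)) U (kGeo i).eta (kGeo i).L (levV1 i) α₁ a)
    (V : CfgY (Matrix (Fin N) (Fin N) ℂ) i) (hV : ∀ μ x, V μ x = fluct (kGeo i).eta a μ x)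
    {δ : ℝ} (hδ : 0 ≤ δ) (Rr : ℝ) (H : Prop) :
    HasMajorant (g := toB6 (geoCK i q) Rr H) (blkBK i q) (avgPieceCKnit b i q V)
      (fun y y₁ => ((M₂ * ∑ j, ‖b j‖) * kappaAvKnit d ℓ N b₁ ϱ' ((((ℓ + 1 : ℕ) : ℝ)) * α₁) δ) * ((((ℓ + 1 : ℕ) : ℝ)) * α₁) *
        ((geoCK i q).len y ^ 2)⁻¹ * Real.exp (-(δ * (geoCK i q).dist y y₁))) :=
  hasMajorant_avgPieceCKnit b i q hα₀ hMα hα' hα3 hα8 hK hϱ' hϱ hsmall' hc₃' hϱ'1 hE hdX hsmall hc₃ hM₂ hrepr hb₀ hb₁ a (by positivity) hα₁ϱ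
    (fun κ μ x hx => endBlock_small_of_cplx337_cube i h37 q κ μ x hx) V hV hδ Rr H

end Majorant

end Literature.MathematicalPhysics.QuantumFieldTheory.Balaban1983to89.B9Cor35GDirKnitAvgPieceMajorant

end
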